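import Literature.NumberTheory.NumberFields.RescaledCompletion
import Literature.NumberTheory.Automorphic.GaloisActionPlaces
import Literature.IUT.LogVolume.LocalUnitLogEquivariance
import HarnessLib

/-!
# Galois transport of the rescaled completions `K_w ≃ K_{σw}` as ISOMETRIC `ℚ_p`-algebra isomorphisms,
# and of their `p`-adic unit logarithms / log-shells

Cassels–Fröhlich, *Algebraic Number Theory* (1967), Ch. VII (Tate) §1.1: for a Galois automorphism `σ` of
a number field `K` and a finite place `w`, "`σ` induces by continuity an isomorphism `σ_w : K_w → K_{σw}`";
conjugate places have the same local degree, residue cardinality and ramification. The tree already has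
this transport at the level of Mathlib's adic completions (`Literature.NumberTheory.Automorphic.
galAdicCompletionEquiv`, `valued_galAdicCompletionMap`, valuation-preserving and continuous). The
[IUTchIV] §1 / Dupuy–Hilado §3–4 log-volume files of the abc-iut cell, however, are written over fields of
the norm-side MLF class `[NontriviallyNormedField k] [NormedAlgebra ℚ_[p] k]` and instantiate the
completions through abc-iut-S7's **rescaled completion** `RescaledCompletion K p w hw` (`K_w` normed by
`‖·‖_w^{1/n_w}` with the unique continuous `ℚ_p`-algebra structure). THIS FILE transports along `σ` at
that level — everything PROVED, no named facts:

* (the generic input — a NORM-PRESERVING ring homomorphism between complete ultrametric normed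
  `ℚ_p`-algebras commutes with `log_p` and carries `log_p(R^×)` onto `log_p(R'^×)` — is abc-iut-w5-d242's
  `LocalUnitLogEquivariance.lean`: `unitLog_map`, `image_logUnits`; consumed BY NAME);
* Galois part (namespace `Literature.NumberTheory.NumberFields.RescaledCompletion`), for `σ : K ≃ₐ[F₀] K`,
  `σ • w = w'`, `w ∣ p`: `galAdicCompletionMap` is `ℚ_p`-LINEAR for the canonical `ℚ_p`-algebra structures
  (uniqueness of the continuous `ℚ_p → K_{w'}`, `LocalField.eq_algebraMap_adicCompletionPadicAlgebra`);
  the `ℚ_p`-algebra isomorphism `galAlgEquiv σ h : RescaledCompletion K p w hw ≃ₐ[ℚ_[p]]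
  RescaledCompletion K p w' hw'`; equality of local degrees `n_w = n_{w'}` (`finrank` transport) and of
  the rescaling bases `𝐍(w)^{1/n_w}`; **`‖galAlgEquiv σ h x‖ = ‖x‖`** (`norm_galAlgEquiv`), packaged as a
  linear isometry `galIsometryEquiv`; transport of `log_p` and of the log-shell lattice
  `log_p(R^×)` (`unitLog_galAlgEquiv`, `image_logUnits_galAlgEquiv`); and, for `K/F₀` GALOIS, the
  existence of such an isometric `ℚ_p`-algebra isomorphism between the rescaled completions at ANY two
  places of `K` over the same place of `F₀` (`exists_algEquiv_norm_eq_of_under_eq`, transitivity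
  Cassels–Fröhlich VII Prop. 1.2 (ii)).

Consumer (abc-iut cell): per-summand Galois invariance of the tensor-packet log-shell volumes at
conjugate tuples of places (the [IUTchI] Rmk. 3.1.5 descent `V(K) → V̲ ≅ V_mod` of packet averages,
`WeightDescentExpectation.lean`). Nothing here bears on [IUTchIII] Cor. 3.12.
-/

noncomputable section

/-! ## 1. A norm-preserving ring isomorphism maps closed balls onto closed balls -/

namespace Literature.IUT.LogVolume

open Metric Set

/-- A norm-preserving ring isomorphism maps the closed ball `{‖x‖ ≤ r}` onto `{‖x‖ ≤ r}` (in particular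
the rings of integers `R = {‖x‖ ≤ 1}` correspond). [cite: NeukirchANT1999, Ch. II §4] -/
theorem image_closedBall_zero_of_norm_map {k k' : Type*} [NontriviallyNormedField k]
    [NontriviallyNormedField k'] (e : k ≃+* k') (he : ∀ x, ‖e x‖ = ‖x‖) (r : ℝ) :
    e '' closedBall (0 : k) r = closedBall (0 : k') r := by
  ext z
  simp only [Set.mem_image, mem_closedBall_zero_iff]
  constructor
  · rintro ⟨x, hx, rfl⟩; rwa [he]
  · intro hz; exact ⟨e.symm z, by rw [← he, RingEquiv.apply_symm_apply]; exact hz, e.apply_symm_apply z⟩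

end Literature.IUT.LogVolume

/-! ## 2. The Galois transport of the rescaled completions -/

namespace Literature.NumberTheory.NumberFields

namespace RescaledCompletion

open NumberField IsDedekindDomain Literature.NumberTheory.Automorphic
  Literature.NumberTheory.GaloisRepresentations Literature.IUT.LogVolume
open scoped Pointwise

variable {F₀ : Type} [Field F₀] {K : Type} [Field K] [NumberField K] [Algebra F₀ K]
variable (p : ℕ) [Fact p.Prime]

omit [NumberField K] [Fact p.Prime] in
/-- `p ∈ σ • w ↔ p ∈ w` (`σ` fixes the rational integer `p`; conjugate places lie over the same rational prime).
[cite: CasselsFrohlichANT1967, Ch. VII §1.1] -/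
theorem natCast_mem_smul_asIdeal_iff (σ : K ≃ₐ[F₀] K) (w : HeightOneSpectrum (𝓞 K)) :
    ((p : ℕ) : 𝓞 K) ∈ (σ • w).asIdeal ↔ ((p : ℕ) : 𝓞 K) ∈ w.asIdeal := by
  have hfix : σ • ((p : ℕ) : 𝓞 K) = (p : 𝓞 K) := map_natCast (MulSemiringAction.toRingHom _ (𝓞 K) σ) p
  rw [← HeightOneSpectrum.smul_mem_smul_asIdeal_iff σ w ((p : ℕ) : 𝓞 K), hfix]

omit [NumberField K] [Fact p.Prime] in
/-- If `σ • w = w'` and `p ∈ w` then `p ∈ w'`. [cite: CasselsFrohlichANT1967, Ch. VII §1.1] -/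
theorem natCast_mem_of_smul_eq {σ : K ≃ₐ[F₀] K} {w w' : HeightOneSpectrum (𝓞 K)} (h : σ • w = w')
    (hw : ((p : ℕ) : 𝓞 K) ∈ w.asIdeal) : ((p : ℕ) : 𝓞 K) ∈ w'.asIdeal := by
  rw [← h]; exact (natCast_mem_smul_asIdeal_iff p σ w).mpr hw

variable {p}
variable (σ : K ≃ₐ[F₀] K) {w w' : HeightOneSpectrum (𝓞 K)} (h : σ • w = w')
  (hw : ((p : ℕ) : 𝓞 K) ∈ w.asIdeal) (hw' : ((p : ℕ) : 𝓞 K) ∈ w'.asIdeal)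

/-- **`σ_w : K_w → K_{w'}` is `ℚ_p`-linear** for the canonical (unique continuous) `ℚ_p`-algebra structures
of the two completions: `σ_w ∘ (ℚ_p → K_w)` is a continuous ring homomorphism `ℚ_p → K_{w'}`, hence the
canonical one. [cite: CasselsFrohlichANT1967, Ch. VII §1.1] -/
theorem galAdicCompletionMap_algebraMap_padic (c : ℚ_[p]) :
    galAdicCompletionMap σ h
        ((letI := LocalField.adicCompletionPadicAlgebra w p hw; algebraMap ℚ_[p] (w.adicCompletion K)) c) =
      (letI := LocalField.adicCompletionPadicAlgebra w' p hw'; algebraMap ℚ_[p] (w'.adicCompletion K)) c := by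
  letI i₁ := LocalField.adicCompletionPadicAlgebra w p hw
  let φ : ℚ_[p] →+* w'.adicCompletion K := (galAdicCompletionMap (L := K) σ h).comp (algebraMap ℚ_[p] _)
  have hφ : Continuous φ :=
    (continuous_galAdicCompletionMap K σ h).comp (LocalField.continuous_algebraMap_adicCompletionPadicAlgebra w p hw)
  have := LocalField.eq_algebraMap_adicCompletionPadicAlgebra (v := w') (ℓ := p) hw' φ hφ
  exact congrArg (fun ψ : ℚ_[p] →+* w'.adicCompletion K => ψ c) this

/-- The transport as a ring isomorphism of the RESCALED completions (same map as
`galAdicCompletionEquiv`, read through the identity `of : K_w ≃+* RescaledCompletion`).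
[cite: CasselsFrohlichANT1967, Ch. VII §1.1] -/
def galRingEquiv : RescaledCompletion K p w hw ≃+* RescaledCompletion K p w' hw' :=
  (of K p w hw).symm.trans ((galAdicCompletionEquiv (L := K) σ h).trans (of K p w' hw'))

omit [Fact p.Prime] in
/-- `galRingEquiv` on elements (definitional). [cite: CasselsFrohlichANT1967, Ch. VII §1.1] -/
theorem galRingEquiv_apply (x : RescaledCompletion K p w hw) :
    galRingEquiv σ h hw hw' x = of K p w' hw' (galAdicCompletionMap σ h ((of K p w hw).symm x)) := rfl

/-- **The Galois transport `σ_w` as a `ℚ_p`-ALGEBRA isomorphism of the rescaled completions**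
`RescaledCompletion K p w ≃ₐ[ℚ_p] RescaledCompletion K p (σ w)`. [cite: CasselsFrohlichANT1967, Ch. VII §1.1] -/
def galAlgEquiv : RescaledCompletion K p w hw ≃ₐ[ℚ_[p]] RescaledCompletion K p w' hw' :=
  AlgEquiv.ofRingEquiv (f := galRingEquiv σ h hw hw') fun c => by
    rw [galRingEquiv_apply, algebraMap_eq, algebraMap_eq]
    exact congrArg (of K p w' hw') (galAdicCompletionMap_algebraMap_padic σ h hw hw' c)

/-- `galAlgEquiv` on elements (definitional). [cite: CasselsFrohlichANT1967, Ch. VII §1.1] -/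
theorem galAlgEquiv_apply (x : RescaledCompletion K p w hw) :
    galAlgEquiv σ h hw hw' x = of K p w' hw' (galAdicCompletionMap σ h ((of K p w hw).symm x)) := rfl

/-- On `K` the transport is `σ`: `σ_w(x) = σ x` for `x ∈ K`. [cite: CasselsFrohlichANT1967, Ch. VII §1.1] -/
theorem galAlgEquiv_coe (x : K) :
    galAlgEquiv σ h hw hw' (of K p w hw (x : w.adicCompletion K)) = of K p w' hw' ((σ x : K) : w'.adicCompletion K) := by
  rw [galAlgEquiv_apply, RingEquiv.symm_apply_apply, galAdicCompletionMap_coe_algEquiv]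

/-- **`σ_w` preserves the valuations** (`v_{w'}(σ_w y) = v_w(y)`, same value group `ℤₘ₀`).
[cite: CasselsFrohlichANT1967, Ch. VII §1.1] -/
theorem valued_galAlgEquiv (x : RescaledCompletion K p w hw) :
    Valued.v (galAlgEquiv σ h hw hw' x) = Valued.v x :=
  valued_galAdicCompletionMap K σ h ((of K p w hw).symm x)

include σ h hw hw' in
/-- **Conjugate places have the same local degree** `n_w = n_{w'}` (`n_w = [K_w : ℚ_p]`, and `σ_w` is a
`ℚ_p`-linear isomorphism). [cite: CasselsFrohlichANT1967, Ch. VII §1.1] -/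
theorem localDeg_eq_of_smul_eq : localDeg K w = localDeg K w' := by
  have h₁ : localDeg K w = Module.finrank ℚ_[p] (RescaledCompletion K p w hw) := localDeg_eq_finrank K p w hw
  have h₂ : localDeg K w' = Module.finrank ℚ_[p] (RescaledCompletion K p w' hw') :=
    localDeg_eq_finrank K p w' hw'
  rw [h₁, h₂]
  exact (galAlgEquiv σ h hw hw').toLinearEquiv.finrank_eq

include σ h hw hw' in
/-- **Conjugate places have the same rescaling base** `𝐍(w)^{1/n_w} = 𝐍(w')^{1/n_{w'}}` (same residue
cardinality, same local degree). [cite: CasselsFrohlichANT1967, Ch. VII §1.1] -/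
theorem base_eq_of_smul_eq : base K w = base K w' := by
  unfold base
  rw [localDeg_eq_of_smul_eq σ h hw hw', ← h, HeightOneSpectrum.absNorm_algEquiv_smul]

/-- `WithZeroMulInt.toNNReal` only depends on the base (proof-irrelevance helper). [folklore] -/
private theorem toNNReal_congr_base {b b' : NNReal} (hb : b ≠ 0) (hb' : b' ≠ 0) (hbb' : b = b')
    (t : WithZero (Multiplicative ℤ)) : WithZeroMulInt.toNNReal hb t = WithZeroMulInt.toNNReal hb' t := by
  subst hbb'; rfl

/-- **`σ_w` is an ISOMETRY of the rescaled completions**: `‖σ_w x‖' = ‖x‖'` (both norms are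
`toNNReal_{𝐍(·)^{1/n}}` of the same valuation, with equal bases). [cite: CasselsFrohlichANT1967, Ch. VII §1.1] -/
theorem norm_galAlgEquiv (x : RescaledCompletion K p w hw) : ‖galAlgEquiv σ h hw hw' x‖ = ‖x‖ := by
  rw [norm_def K p w' hw', norm_def K p w hw, valued_galAlgEquiv,
    toNNReal_congr_base _ _ (base_eq_of_smul_eq σ h hw hw').symm]

/-- `σ_w⁻¹` is an isometry too. [cite: CasselsFrohlichANT1967, Ch. VII §1.1] -/
theorem norm_galAlgEquiv_symm (y : RescaledCompletion K p w' hw') :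
    ‖(galAlgEquiv σ h hw hw').symm y‖ = ‖y‖ := by
  conv_rhs => rw [← (galAlgEquiv σ h hw hw').apply_symm_apply y]
  rw [norm_galAlgEquiv]

/-- **The Galois transport as a `ℚ_p`-linear ISOMETRIC isomorphism** `RescaledCompletion K p w ≃ₗᵢ[ℚ_p]
RescaledCompletion K p (σ w)`. [cite: CasselsFrohlichANT1967, Ch. VII §1.1] -/
def galIsometryEquiv : RescaledCompletion K p w hw ≃ₗᵢ[ℚ_[p]] RescaledCompletion K p w' hw' :=
  { (galAlgEquiv σ h hw hw').toLinearEquiv with norm_map' := norm_galAlgEquiv σ h hw hw' }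

/-- `galIsometryEquiv` is `galAlgEquiv` as a function. [cite: CasselsFrohlichANT1967, Ch. VII §1.1] -/
@[simp] theorem coe_galIsometryEquiv : ⇑(galIsometryEquiv σ h hw hw') = galAlgEquiv σ h hw hw' := rfl

/-- `σ_w` is continuous ("`σ` induces by continuity an isomorphism `σ_w`"). [cite: CasselsFrohlichANT1967, Ch. VII §1.1] -/
theorem continuous_galAlgEquiv : Continuous (galAlgEquiv σ h hw hw') :=
  (galIsometryEquiv σ h hw hw').continuous

/-- **`σ_w` commutes with the `p`-adic unit logarithm**: `log_p(σ_w x) = σ_w(log_p x)`.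
[cite: NeukirchANT1999, Ch. II (5.5)] -/
theorem unitLog_galAlgEquiv (x : RescaledCompletion K p w hw) :
    unitLog (galAlgEquiv σ h hw hw' x) = galAlgEquiv σ h hw hw' (unitLog x) :=
  unitLog_map p (galAlgEquiv σ h hw hw' : RescaledCompletion K p w hw →+* RescaledCompletion K p w' hw')
    (norm_galAlgEquiv σ h hw hw') x

/-- **`σ_w` maps the log-shell lattice `log_p(R_w^×)` ONTO `log_p(R_{w'}^×)`** (hence every scalar multiple
`c·log_p(R^×)`, e.g. the log-shell `(p*)⁻¹·log_p(R^×)` of [IUTchIII] Def. 1.1 (i), onto the corresponding one).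
[cite: NeukirchANT1999, Ch. II (5.5)] -/
theorem image_logUnits_galAlgEquiv :
    galAlgEquiv σ h hw hw' '' logUnits (RescaledCompletion K p w hw) = logUnits (RescaledCompletion K p w' hw') :=
  image_logUnits p (galAlgEquiv σ h hw hw').toRingEquiv (norm_galAlgEquiv σ h hw hw')

/-- `σ_w` maps `c·log_p(R_w^×)` onto `c·log_p(R_{w'}^×)` for every scalar `c ∈ ℚ_p`. [cite: NeukirchANT1999, Ch. II (5.5)] -/
theorem image_smul_logUnits_galAlgEquiv (c : ℚ_[p]) :
    galAlgEquiv σ h hw hw' '' (c • logUnits (RescaledCompletion K p w hw)) =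
      c • logUnits (RescaledCompletion K p w' hw') := by
  rw [Set.image_smul_comm (galAlgEquiv σ h hw hw') c _ (fun x => map_smul (galAlgEquiv σ h hw hw') c x),
    image_logUnits_galAlgEquiv]

/-- `σ_w` maps the closed ball `{‖x‖' ≤ r}` of `K_w` onto that of `K_{w'}` (e.g. `R_w` onto `R_{w'}`).
[cite: CasselsFrohlichANT1967, Ch. VII §1.1] -/
theorem image_closedBall_galAlgEquiv (r : ℝ) :
    galAlgEquiv σ h hw hw' '' Metric.closedBall 0 r = Metric.closedBall 0 r :=
  image_closedBall_zero_of_norm_map (galAlgEquiv σ h hw hw').toRingEquiv (norm_galAlgEquiv σ h hw hw') r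

/-! ## 3. Galois extensions: any two completions over the same place of `F₀` are isometrically isomorphic -/

/-- **For `K/F₀` Galois and places `w, w'` of `K` over `p` lying over the SAME place of `F₀`, the rescaled
completions are isomorphic as normed `ℚ_p`-algebras** (some `σ ∈ Gal(K/F₀)` has `σ • w = w'`, transitivity
Cassels–Fröhlich VII Prop. 1.2 (ii); then `σ_w`). [cite: CasselsFrohlichANT1967, Ch. VII Prop. 1.2 (ii)] -/
theorem exists_algEquiv_norm_eq_of_under_eq [NumberField F₀] [IsGalois F₀ K] (w w' : HeightOneSpectrum (𝓞 K))
    (hw : ((p : ℕ) : 𝓞 K) ∈ w.asIdeal) (hw' : ((p : ℕ) : 𝓞 K) ∈ w'.asIdeal)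
    (hww' : w.under (𝓞 F₀) = w'.under (𝓞 F₀)) :
    ∃ e : RescaledCompletion K p w hw ≃ₐ[ℚ_[p]] RescaledCompletion K p w' hw', ∀ x, ‖e x‖ = ‖x‖ := by
  obtain ⟨σ, hσ⟩ := HeightOneSpectrum.exists_algEquiv_smul_eq (F := F₀) hww'
  exact ⟨galAlgEquiv σ hσ hw hw', norm_galAlgEquiv σ hσ hw hw'⟩

/-- … in particular they have the same local degree `n_w = n_{w'}`. [cite: NeukirchANT1999, Ch. II (6.8)] -/
theorem localDeg_eq_of_under_eq [NumberField F₀] [IsGalois F₀ K] (w w' : HeightOneSpectrum (𝓞 K))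
    (hw : ((p : ℕ) : 𝓞 K) ∈ w.asIdeal) (hw' : ((p : ℕ) : 𝓞 K) ∈ w'.asIdeal)
    (hww' : w.under (𝓞 F₀) = w'.under (𝓞 F₀)) : localDeg K w = localDeg K w' := by
  obtain ⟨σ, hσ⟩ := HeightOneSpectrum.exists_algEquiv_smul_eq (F := F₀) hww'
  exact localDeg_eq_of_smul_eq σ hσ hw hw'

/-- … and log-shell lattices which correspond under an isometric `ℚ_p`-algebra isomorphism.
[cite: NeukirchANT1999, Ch. II (5.5)] -/
theorem exists_algEquiv_image_logUnits_of_under_eq [NumberField F₀] [IsGalois F₀ K]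
    (w w' : HeightOneSpectrum (𝓞 K)) (hw : ((p : ℕ) : 𝓞 K) ∈ w.asIdeal) (hw' : ((p : ℕ) : 𝓞 K) ∈ w'.asIdeal)
    (hww' : w.under (𝓞 F₀) = w'.under (𝓞 F₀)) :
    ∃ e : RescaledCompletion K p w hw ≃ₐ[ℚ_[p]] RescaledCompletion K p w' hw',
      (∀ x, ‖e x‖ = ‖x‖) ∧ e '' logUnits (RescaledCompletion K p w hw) = logUnits (RescaledCompletion K p w' hw') := by
  obtain ⟨σ, hσ⟩ := HeightOneSpectrum.exists_algEquiv_smul_eq (F := F₀) hww'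
  exact ⟨galAlgEquiv σ hσ hw hw', norm_galAlgEquiv σ hσ hw hw', image_logUnits_galAlgEquiv σ hσ hw hw'⟩

end RescaledCompletion

end Literature.NumberTheory.NumberFields

end
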